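import Summits.Ventures.Crystal3D.Theorems.StickyWulffConstantNoReconstructionGainLowCoordGeom
import Summits.Ventures.Crystal3D.Theorems.StickyWulffConstantNoReconstructionGainSteepFlatNoGain
import Summits.Ventures.Crystal3D.StickySpheres.ContactGraph
import Mathlib.MeasureTheory.Measure.Lebesgue.VolumeOfBalls
import Mathlib.MeasureTheory.Measure.Haar.InnerProductSpace
import Mathlib.MeasureTheory.Constructions.Pi
import HarnessLib

/-!
# The blanket bound implies `NoReconstructionGain` at the basal normals `±e₃`

HONEST FRAMING. Part of the venture `Summits/Ventures/Crystal3D` (cell `crystal3d-full`), helper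
`--supports` the crux `NoReconstructionGain` (stmt-Ventures-19144, route
`route-Ventures-StickyWulffConstant`).  Planner cf-p1's BLANKET line (gen 14,
`Cruxes/…/blanket/Blanket.lean`; the conjecture survived cf-p2's census R27, its dissolution form D
did not): the GLUE targets `BlanketToNRGAt3` / `BlanketToNRGAtNeg3`, proved here DEF-FREE (the
planner's `BlanketBound`, `shadowSlab`, `shadowArea`, `blanketRadius`, `NoReconstructionGainAt`
unfolded verbatim, so that `theorem … : BlanketToNRGAt3 := blanket_noReconstructionGain_e3` is a
one-liner once a definitions file lands):

  if `2√3 · Area(shadow_ν ⋃ᵢ B̄(xᵢ, 1/√3)) ≤ 6N − C(x)` for every finite unit packing and every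
  unit `ν` (the BLANKET BOUND), then the crux `NoReconstructionGain` holds at `ν = e₃` and at
  `ν = −e₃` with `R = 1`, `C = 4π`.

Proof: the sample contains the full close-packed layer `k = ∓2` of `Λ₀` out to lateral radius `ρ`;
its `1/√3`-discs cover the disc of radius `ρ − 1/√3` (covering radius of the unit triangular
lattice, `triangular_covering`: nearest of the two bracketing rows), so the shadow contains the
cylinder of radius `ρ − 1/√3` and unit height, of volume `π(ρ − 1/√3)²` (`volume_cylinder_fin_three`,
product measure and `EuclideanSpace.volume_closedBall_fin_two`); and `φ(±e₃) = √3`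
(`phiFcc_single_two`).

WHAT THIS IS NOT: a proof of the blanket bound; other normals (for `ν ∉ {±(111)}` the `P`-free
constant is false); rung F-C1 not moved.
-/

noncomputable section

namespace Summit.Ventures.Crystal3D.Theorems

open Summit.Ventures.Crystal3D Finset MeasureTheory Set
open Literature.MathematicalPhysics.StatisticalMechanics (barlowPos barlowStacking fccStacking
  constHagg haggLabel_const barlowPos_mem barlowPos_apply_zero barlowPos_apply_one
  barlowPos_apply_two)
open scoped InnerProductSpace

/-! ### Geometry of the basal layer -/

/-- `‖e₃‖ = 1`. -/
theorem norm_e3 : ‖EuclideanSpace.single (2 : Fin 3) (1 : ℝ)‖ = 1 := by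
  have h : ‖EuclideanSpace.single (2 : Fin 3) (1 : ℝ)‖ ^ 2 = 1 := by
    rw [EuclideanSpace.real_norm_sq_eq, Fin.sum_univ_three]
    simp
  have h0 : 0 ≤ ‖EuclideanSpace.single (2 : Fin 3) (1 : ℝ)‖ := norm_nonneg _
  nlinarith [h, h0]

/-- Arithmetic of the nearest-row case. -/
theorem cover_ineq_row (u t : ℝ) (hu0 : 0 ≤ u) (hu1 : u ≤ 1 / 2) (ht0 : 0 ≤ t)
    (h : 2 * u + 3 * t ≤ 2) : u ^ 2 + 3 / 4 * t ^ 2 ≤ 1 / 3 := by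
  have h9 : 9 * t ^ 2 ≤ (2 - 2 * u) ^ 2 := by
    have := mul_nonneg (by linarith : (0 : ℝ) ≤ 2 - 2 * u - 3 * t)
      (by linarith : (0 : ℝ) ≤ 2 - 2 * u + 3 * t)
    nlinarith [this]
  have hA : u ^ 2 + 3 / 4 * t ^ 2 ≤ u ^ 2 + (2 - 2 * u) ^ 2 / 12 := by linarith [h9]
  have hB : 0 ≤ u * (1 - 2 * u) := mul_nonneg hu0 (by linarith)
  nlinarith [hA, hB]

/-- Arithmetic of the next-row case. -/
theorem cover_ineq_next (δ t : ℝ) (hδ0 : 0 ≤ δ) (hδ1 : δ ≤ 1 / 2) (ht1 : t ≤ 1)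
    (h : 2 < 2 * δ + 3 * t) : (δ - 1 / 2) ^ 2 + 3 / 4 * (1 - t) ^ 2 ≤ 1 / 3 := by
  have h9 : 9 * (1 - t) ^ 2 ≤ (1 + 2 * δ) ^ 2 := by
    have := mul_nonneg (by linarith : (0 : ℝ) ≤ 2 * δ + 3 * t - 2)
      (by linarith : (0 : ℝ) ≤ 4 + 2 * δ - 3 * t)
    nlinarith [this]
  have hA : (δ - 1 / 2) ^ 2 + 3 / 4 * (1 - t) ^ 2 ≤ (δ - 1 / 2) ^ 2 + (1 + 2 * δ) ^ 2 / 12 := by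
    linarith [h9]
  have hB : 0 ≤ δ * (1 - 2 * δ) := mul_nonneg hδ0 (by linarith)
  nlinarith [hA, hB]

/-- **Covering radius of the unit triangular lattice.**  Every point of the plane is within
`1/√3` of a point `(i + j/2 + c₀, (√3/2) j + c₁)`, `i, j ∈ ℤ` (nearest of the two bracketing
rows). -/
theorem triangular_covering (c₀ c₁ w₀ w₁ : ℝ) :
    ∃ i j : ℤ, (w₀ - (i + j / 2 + c₀)) ^ 2 + (w₁ - (Real.sqrt 3 / 2 * j + c₁)) ^ 2 ≤ 1 / 3 := by
  have h3 : Real.sqrt 3 ^ 2 = 3 := Real.sq_sqrt (by norm_num)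
  have h3pos : 0 < Real.sqrt 3 := Real.sqrt_pos.2 (by norm_num)
  -- the row below `w`
  set b : ℝ := (w₁ - c₁) / (Real.sqrt 3 / 2) with hb
  set j₀ : ℤ := ⌊b⌋ with hj₀
  set t : ℝ := b - j₀ with ht
  have ht0 : 0 ≤ t := by rw [ht]; linarith [Int.floor_le b]
  have ht1 : t < 1 := by rw [ht]; linarith [Int.lt_floor_add_one b]
  have hv : w₁ - c₁ = Real.sqrt 3 / 2 * (j₀ + t) := by
    rw [ht, hb]; field_simp; ring
  -- nearest site in the row `j₀`
  set a : ℝ := w₀ - c₀ - j₀ / 2 with ha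
  set i₀ : ℤ := round a with hi₀
  have hδ := abs_sub_round a
  rw [← hi₀, abs_le] at hδ
  set δ : ℝ := a - i₀ with hδdef
  have hsq : ∀ z : ℝ, (Real.sqrt 3 / 2 * z) ^ 2 = 3 / 4 * z ^ 2 := fun z => by
    rw [mul_pow, div_pow, h3]; ring
  by_cases hcase : 2 * |δ| + 3 * t ≤ 2
  · refine ⟨i₀, j₀, ?_⟩
    have e0 : w₀ - (i₀ + (j₀ : ℝ) / 2 + c₀) = δ := by rw [hδdef, ha]; ring
    have e1 : w₁ - (Real.sqrt 3 / 2 * j₀ + c₁) = Real.sqrt 3 / 2 * t := by linarith [hv]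
    rw [e0, e1, hsq, ← sq_abs δ]
    exact cover_ineq_row |δ| t (abs_nonneg δ) (abs_le.2 ⟨by linarith [hδ.1], hδ.2⟩) ht0 hcase
  · push Not at hcase
    have e1 : ∀ i : ℤ, w₁ - (Real.sqrt 3 / 2 * ((j₀ + 1 : ℤ) : ℝ) + c₁) = -(Real.sqrt 3 / 2 * (1 - t)) :=
      fun _ => by push_cast; linarith [hv]
    rcases le_or_gt 0 δ with hδ0 | hδ0
    · refine ⟨i₀, j₀ + 1, ?_⟩
      have e0 : w₀ - (i₀ + ((j₀ + 1 : ℤ) : ℝ) / 2 + c₀) = δ - 1 / 2 := by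
        rw [hδdef, ha]; push_cast; ring
      rw [e0, e1 i₀, neg_sq, hsq]
      rw [abs_of_nonneg hδ0] at hcase
      exact cover_ineq_next δ t hδ0 hδ.2 ht1.le hcase
    · refine ⟨i₀ - 1, j₀ + 1, ?_⟩
      have e0 : w₀ - (((i₀ - 1 : ℤ) : ℝ) + ((j₀ + 1 : ℤ) : ℝ) / 2 + c₀) = -(-δ - 1 / 2) := by
        rw [hδdef, ha]; push_cast; ring
      rw [e0, e1 i₀, neg_sq, neg_sq, hsq]
      rw [abs_of_neg hδ0] at hcase
      exact cover_ineq_next (-δ) t (by linarith) (by linarith [hδ.1]) ht1.le (by linarith)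

/-- **The unit-height cylinder** of radius `s ≥ 0` about the `e₃`-axis has volume `π s²`. -/
theorem volume_cylinder_fin_three (s : ℝ) (hs : 0 ≤ s) :
    volume {y : EuclideanSpace ℝ (Fin 3) | y 0 ^ 2 + y 1 ^ 2 ≤ s ^ 2 ∧ |y 2| ≤ 1 / 2} =
      ENNReal.ofReal s ^ 2 * ENNReal.ofReal Real.pi := by
  set C' : Set (Fin 3 → ℝ) := {f | f 0 ^ 2 + f 1 ^ 2 ≤ s ^ 2 ∧ |f 2| ≤ 1 / 2} with hC'
  have hpre : {y : EuclideanSpace ℝ (Fin 3) | y 0 ^ 2 + y 1 ^ 2 ≤ s ^ 2 ∧ |y 2| ≤ 1 / 2} =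
      (WithLp.ofLp : EuclideanSpace ℝ (Fin 3) → (Fin 3 → ℝ)) ⁻¹' C' := by
    ext y; simp [hC']
  have hC'meas : MeasurableSet C' := by
    have h1 : Measurable fun f : Fin 3 → ℝ => f 0 ^ 2 + f 1 ^ 2 :=
      ((measurable_pi_apply (0 : Fin 3) : Measurable fun f : Fin 3 → ℝ => f 0).pow_const 2).add
        ((measurable_pi_apply (1 : Fin 3) : Measurable fun f : Fin 3 → ℝ => f 1).pow_const 2)
    have h2 : Measurable fun f : Fin 3 → ℝ => |f 2| :=
      continuous_abs.measurable.comp (measurable_pi_apply (2 : Fin 3))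
    rw [hC']
    exact (measurableSet_le h1 measurable_const).inter (measurableSet_le h2 measurable_const)
  rw [hpre, (PiLp.volume_preserving_ofLp (Fin 3)).measure_preimage hC'meas.nullMeasurableSet]
  set D : Set (Fin 2 → ℝ) := {g | g 0 ^ 2 + g 1 ^ 2 ≤ s ^ 2} with hD
  have hsplit : C' = (MeasurableEquiv.piFinSuccAbove (fun _ : Fin 3 => ℝ) 2) ⁻¹'
      (Icc (-(1 / 2 : ℝ)) (1 / 2) ×ˢ D) := by
    ext f
    simp only [hC', hD, Set.mem_setOf_eq, Set.mem_preimage, Set.mem_prod, Set.mem_Icc, abs_le]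
    simp [MeasurableEquiv.piFinSuccAbove, Fin.removeNth, Fin.succAbove]
    constructor
    · rintro ⟨h1, h2, h3⟩; exact ⟨⟨by linarith, h3⟩, h1⟩
    · rintro ⟨⟨h2, h3⟩, h1⟩; exact ⟨h1, by linarith, h3⟩
  rw [hsplit, (volume_preserving_piFinSuccAbove (fun _ : Fin 3 => ℝ) 2).measure_preimage_equiv]
  rw [show (volume : Measure (ℝ × (Fin 2 → ℝ))) = volume.prod volume from rfl, Measure.prod_prod,
    Real.volume_Icc]
  have hDeq : D = (WithLp.toLp 2 : (Fin 2 → ℝ) → EuclideanSpace ℝ (Fin 2)) ⁻¹'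
      Metric.closedBall (0 : EuclideanSpace ℝ (Fin 2)) s := by
    ext g
    simp only [hD, Set.mem_setOf_eq, Set.mem_preimage, Metric.mem_closedBall, dist_zero_right]
    rw [EuclideanSpace.norm_eq, Fin.sum_univ_two]
    simp only [Real.norm_eq_abs, sq_abs]
    rw [Real.sqrt_le_left hs]
  rw [hDeq, (PiLp.volume_preserving_toLp (Fin 2)).measure_preimage
    measurableSet_closedBall.nullMeasurableSet, EuclideanSpace.volume_closedBall_fin_two]
  norm_num

/-- **The basal layer covers the shadow.**  If `x` contains every site of the layer `k₀` of
`Λ₀` of lateral radius `≤ ρ` (`ρ ≥ 1/√3`), then the cylinder of radius `ρ − 1/√3` and height `1`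
about the `e₃`-axis lies in the `e₃`-shadow slab of the `1/√3`-balls about the `x i`. -/
theorem cylinder_subset_shadow (ρ : ℝ) (hρ : (Real.sqrt 3)⁻¹ ≤ ρ) (k₀ : ℤ) {N : ℕ}
    (x : Fin N → EuclideanSpace ℝ (Fin 3))
    (hlayer : ∀ i j : ℤ, barlowPos 1 (Real.sqrt (2 / 3)) constHagg k₀ i j 0 ^ 2 +
      barlowPos 1 (Real.sqrt (2 / 3)) constHagg k₀ i j 1 ^ 2 ≤ ρ ^ 2 →
      ∃ m, x m = barlowPos 1 (Real.sqrt (2 / 3)) constHagg k₀ i j) :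
    {y : EuclideanSpace ℝ (Fin 3) | y 0 ^ 2 + y 1 ^ 2 ≤ (ρ - (Real.sqrt 3)⁻¹) ^ 2 ∧ |y 2| ≤ 1 / 2} ⊆
    {y | (∃ m, ‖y - x m‖ ^ 2 - ⟪y - x m, EuclideanSpace.single (2 : Fin 3) (1 : ℝ)⟫_ℝ ^ 2 ≤
        (Real.sqrt 3)⁻¹ ^ 2) ∧ |⟪y, EuclideanSpace.single (2 : Fin 3) (1 : ℝ)⟫_ℝ| ≤ 1 / 2} := by
  intro y hy
  obtain ⟨hy1, hy2⟩ := hy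
  have h3 : Real.sqrt 3 ^ 2 = 3 := Real.sq_sqrt (by norm_num)
  have h3pos : 0 < Real.sqrt 3 := Real.sqrt_pos.2 (by norm_num)
  have hr2 : (Real.sqrt 3)⁻¹ ^ 2 = 1 / 3 := by rw [inv_pow, h3]; norm_num
  have hr0 : 0 < (Real.sqrt 3)⁻¹ := inv_pos.2 h3pos
  have hinner : ∀ p : EuclideanSpace ℝ (Fin 3), ⟪p, EuclideanSpace.single (2 : Fin 3) (1 : ℝ)⟫_ℝ = p 2 :=
    fun p => by simp [EuclideanSpace.inner_single_right]
  -- the nearest layer site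
  obtain ⟨i, j, hij⟩ := triangular_covering ((k₀ : ℝ) / 2) (Real.sqrt 3 / 2 * ((k₀ : ℝ) / 3)) (y 0) (y 1)
  set p := barlowPos 1 (Real.sqrt (2 / 3)) constHagg k₀ i j with hp
  have hp0 : p 0 = i + (j : ℝ) / 2 + (k₀ : ℝ) / 2 := by
    rw [hp, barlowPos_apply_zero, haggLabel_const]; ring
  have hp1 : p 1 = Real.sqrt 3 / 2 * j + Real.sqrt 3 / 2 * ((k₀ : ℝ) / 3) := by
    rw [hp, barlowPos_apply_one, haggLabel_const]; ring
  have hd : (y 0 - p 0) ^ 2 + (y 1 - p 1) ^ 2 ≤ 1 / 3 := by rw [hp0, hp1]; exact hij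
  -- the site is within lateral radius `ρ`:  `|p| ≤ |y| + |p − y| ≤ (ρ − r) + r`
  have hlat : p 0 ^ 2 + p 1 ^ 2 ≤ ρ ^ 2 := by
    set A := Real.sqrt (y 0 ^ 2 + y 1 ^ 2) with hA
    set B := Real.sqrt ((y 0 - p 0) ^ 2 + (y 1 - p 1) ^ 2) with hB
    have hA0 : 0 ≤ A := Real.sqrt_nonneg _
    have hB0 : 0 ≤ B := Real.sqrt_nonneg _
    have hA2 : A ^ 2 = y 0 ^ 2 + y 1 ^ 2 := Real.sq_sqrt (by positivity)
    have hB2 : B ^ 2 = (y 0 - p 0) ^ 2 + (y 1 - p 1) ^ 2 := Real.sq_sqrt (by positivity)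
    have hAle : A ≤ ρ - (Real.sqrt 3)⁻¹ := by
      rw [hA]; exact Real.sqrt_le_left (by linarith) |>.2 hy1
    have hBle : B ≤ (Real.sqrt 3)⁻¹ := by
      rw [hB, Real.sqrt_le_left hr0.le, hr2]; exact hd
    -- Cauchy–Schwarz in the plane
    have hCS : y 0 * (p 0 - y 0) + y 1 * (p 1 - y 1) ≤ A * B := by
      have hsq : (y 0 * (p 0 - y 0) + y 1 * (p 1 - y 1)) ^ 2 ≤ (A * B) ^ 2 := by
        rw [mul_pow, hA2, hB2]
        nlinarith [sq_nonneg (y 0 * (p 1 - y 1) - y 1 * (p 0 - y 0))]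
      exact abs_le_of_sq_le_sq' hsq (mul_nonneg hA0 hB0) |>.2
    have hexp : p 0 ^ 2 + p 1 ^ 2 = A ^ 2 + 2 * (y 0 * (p 0 - y 0) + y 1 * (p 1 - y 1)) + B ^ 2 := by
      rw [hA2, hB2]; ring
    have hρ' : A + B ≤ ρ := by linarith
    nlinarith [hρ', hA0, hB0]
  obtain ⟨m, hm⟩ := hlayer i j hlat
  refine ⟨⟨m, ?_⟩, by rw [hinner]; exact hy2⟩
  rw [hm, hinner, EuclideanSpace.real_norm_sq_eq, Fin.sum_univ_three, hr2]
  simp only [PiLp.sub_apply]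
  linarith [hd]

/-- The shadow slab is bounded (hence of finite volume). -/
theorem shadow_subset_closedBall {N : ℕ} (x : Fin N → EuclideanSpace ℝ (Fin 3)) (r : ℝ) (hr : 0 ≤ r)
    (ν : EuclideanSpace ℝ (Fin 3)) (hν : ‖ν‖ = 1) :
    {y : EuclideanSpace ℝ (Fin 3) | (∃ m, ‖y - x m‖ ^ 2 - ⟪y - x m, ν⟫_ℝ ^ 2 ≤ r ^ 2) ∧
        |⟪y, ν⟫_ℝ| ≤ 1 / 2} ⊆
      Metric.closedBall (0 : EuclideanSpace ℝ (Fin 3)) (2 * ∑ m, ‖x m‖ + r + 1 / 2) := by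
  rintro y ⟨⟨m, hm⟩, hy⟩
  rw [Metric.mem_closedBall, dist_zero_right]
  have h1 : |⟪y - x m, ν⟫_ℝ| ≤ 1 / 2 + ‖x m‖ := by
    rw [inner_sub_left]
    have := abs_real_inner_le_norm (x m) ν
    rw [hν, mul_one] at this
    have := abs_sub (⟪y, ν⟫_ℝ) (⟪x m, ν⟫_ℝ)
    linarith
  have h2 : ‖y - x m‖ ≤ r + (1 / 2 + ‖x m‖) := by
    have hsq : ‖y - x m‖ ^ 2 ≤ (r + (1 / 2 + ‖x m‖)) ^ 2 := by
      have habs : ⟪y - x m, ν⟫_ℝ ^ 2 ≤ (1 / 2 + ‖x m‖) ^ 2 := by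
        rw [← sq_abs]; exact pow_le_pow_left₀ (abs_nonneg _) h1 2
      nlinarith [norm_nonneg (x m)]
    exact (abs_le_of_sq_le_sq' hsq (by positivity)).2
  have h3 : ‖x m‖ ≤ ∑ m, ‖x m‖ := single_le_sum (fun i _ => norm_nonneg (x i)) (mem_univ m)
  calc ‖y‖ = ‖(y - x m) + x m‖ := by rw [sub_add_cancel]
    _ ≤ ‖y - x m‖ + ‖x m‖ := norm_add_le _ _
    _ ≤ 2 * ∑ m, ‖x m‖ + r + 1 / 2 := by linarith

/-- **Core step.**  If `x` contains the layer `k₀` of `Λ₀` out to lateral radius `ρ ≥ 1` and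
the blanket inequality holds for `x` at `ν = e₃`, then `2√3 π ρ² − 4π ρ ≤ 6N − C(x)`. -/
theorem blanket_core (ρ : ℝ) (hρ : 1 ≤ ρ) (k₀ : ℤ) {N : ℕ} (x : Fin N → EuclideanSpace ℝ (Fin 3))
    (hlayer : ∀ i j : ℤ, barlowPos 1 (Real.sqrt (2 / 3)) constHagg k₀ i j 0 ^ 2 +
      barlowPos 1 (Real.sqrt (2 / 3)) constHagg k₀ i j 1 ^ 2 ≤ ρ ^ 2 →
      ∃ m, x m = barlowPos 1 (Real.sqrt (2 / 3)) constHagg k₀ i j)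
    (hblanket : 2 * Real.sqrt 3 * (volume {y : EuclideanSpace ℝ (Fin 3) |
        (∃ m, ‖y - x m‖ ^ 2 - ⟪y - x m, EuclideanSpace.single (2 : Fin 3) (1 : ℝ)⟫_ℝ ^ 2 ≤
          (Real.sqrt 3)⁻¹ ^ 2) ∧
        |⟪y, EuclideanSpace.single (2 : Fin 3) (1 : ℝ)⟫_ℝ| ≤ 1 / 2}).toReal ≤
      6 * (N : ℝ) - (numContacts x : ℝ)) :
    2 * Real.sqrt 3 * Real.pi * ρ ^ 2 - 4 * Real.pi * ρ ≤ 6 * (N : ℝ) - (numContacts x : ℝ) := by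
  have h3 : Real.sqrt 3 ^ 2 = 3 := Real.sq_sqrt (by norm_num)
  have h3pos : 0 < Real.sqrt 3 := Real.sqrt_pos.2 (by norm_num)
  have h3le : Real.sqrt 3 ≤ 2 := by nlinarith
  have hr0 : 0 < (Real.sqrt 3)⁻¹ := inv_pos.2 h3pos
  have hrle : (Real.sqrt 3)⁻¹ ≤ 1 := inv_le_one_of_one_le₀ (by nlinarith)
  have hrs : Real.sqrt 3 * (Real.sqrt 3)⁻¹ = 1 := mul_inv_cancel₀ h3pos.ne'
  have hν : ‖EuclideanSpace.single (2 : Fin 3) (1 : ℝ)‖ = 1 := norm_e3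
  set s := ρ - (Real.sqrt 3)⁻¹ with hs
  have hs0 : 0 ≤ s := by rw [hs]; linarith
  -- the shadow contains the cylinder of radius `s`, and has finite volume
  have hsub := cylinder_subset_shadow ρ (by linarith) k₀ x hlayer
  have hfin : volume {y : EuclideanSpace ℝ (Fin 3) |
      (∃ m, ‖y - x m‖ ^ 2 - ⟪y - x m, EuclideanSpace.single (2 : Fin 3) (1 : ℝ)⟫_ℝ ^ 2 ≤
        (Real.sqrt 3)⁻¹ ^ 2) ∧ |⟪y, EuclideanSpace.single (2 : Fin 3) (1 : ℝ)⟫_ℝ| ≤ 1 / 2} ≠ ⊤ :=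
    (lt_of_le_of_lt (measure_mono (shadow_subset_closedBall x _ hr0.le _ hν))
      measure_closedBall_lt_top).ne
  have hvol := volume_cylinder_fin_three s hs0
  have hmono := ENNReal.toReal_mono hfin (measure_mono hsub)
  rw [hvol, ENNReal.toReal_mul, ← ENNReal.ofReal_pow hs0, ENNReal.toReal_ofReal (by positivity),
    ENNReal.toReal_ofReal Real.pi_pos.le] at hmono
  -- `2√3 · π s² = 2√3 π ρ² − 4π ρ + 2π/√3 ≥ 2√3 π ρ² − 4π ρ`
  have hexp : 2 * Real.sqrt 3 * (s ^ 2 * Real.pi) =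
      2 * Real.sqrt 3 * Real.pi * ρ ^ 2 - 4 * Real.pi * ρ + 2 * Real.pi * (Real.sqrt 3)⁻¹ := by
    rw [hs]
    have h' : Real.sqrt 3 * (Real.sqrt 3)⁻¹ ^ 2 = (Real.sqrt 3)⁻¹ := by
      rw [sq, ← mul_assoc, hrs, one_mul]
    linear_combination (-4 * Real.pi * ρ) * hrs + 2 * Real.pi * h'
  have hm2 : 2 * Real.sqrt 3 * (s ^ 2 * Real.pi) ≤ 2 * Real.sqrt 3 * (volume {y : EuclideanSpace ℝ (Fin 3) |
      (∃ m, ‖y - x m‖ ^ 2 - ⟪y - x m, EuclideanSpace.single (2 : Fin 3) (1 : ℝ)⟫_ℝ ^ 2 ≤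
        (Real.sqrt 3)⁻¹ ^ 2) ∧ |⟪y, EuclideanSpace.single (2 : Fin 3) (1 : ℝ)⟫_ℝ| ≤ 1 / 2}).toReal :=
    mul_le_mul_of_nonneg_left hmono (by positivity)
  have hpos : 0 ≤ 2 * Real.pi * (Real.sqrt 3)⁻¹ := by positivity
  linarith [hm2, hexp, hblanket, hpos]

/-- **`BlanketToNRGAt3`** (planner cf-p1 g14's glue target, def-free: `BlanketBound →
NoReconstructionGainAt e₃` with both unfolded).  The blanket bound implies `NoReconstructionGain`
at `ν = e₃` for every coordination, with `R = 1`, `C = 4π`. -/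
theorem blanket_noReconstructionGain_e3 :
    (∀ (N : ℕ) (x : Fin N → EuclideanSpace ℝ (Fin 3)), IsUnitPacking x →
      ∀ ν : EuclideanSpace ℝ (Fin 3), ‖ν‖ = 1 →
        2 * Real.sqrt 3 * (volume {y : EuclideanSpace ℝ (Fin 3) |
          (∃ i, ‖y - x i‖ ^ 2 - ⟪y - x i, ν⟫_ℝ ^ 2 ≤ (Real.sqrt 3)⁻¹ ^ 2) ∧
          |⟪y, ν⟫_ℝ| ≤ 1 / 2}).toReal ≤ 6 * (N : ℝ) - (numContacts x : ℝ)) →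
    ∃ R C : ℝ, 0 < R ∧ ∀ ρ : ℝ, R ≤ ρ →
      ∀ (N : ℕ) (x : Fin N → EuclideanSpace ℝ (Fin 3)), IsUnitPacking x →
        (∀ p ∈ fccStacking 1 (Real.sqrt (2 / 3)),
            -(2 * R) ≤ ⟪p, EuclideanSpace.single (2 : Fin 3) (1 : ℝ)⟫_ℝ →
            ⟪p, EuclideanSpace.single (2 : Fin 3) (1 : ℝ)⟫_ℝ ≤ -R →
            ‖p‖ ^ 2 - ⟪p, EuclideanSpace.single (2 : Fin 3) (1 : ℝ)⟫_ℝ ^ 2 ≤ ρ ^ 2 → ∃ i, x i = p) →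
          2 * (Real.sqrt 2 / 4 *
                ∑ᶠ w ∈ {w ∈ fccStacking 1 (Real.sqrt (2 / 3)) | ‖w‖ = 1},
                  |⟪w, EuclideanSpace.single (2 : Fin 3) (1 : ℝ)⟫_ℝ|) *
              Real.pi * ρ ^ 2 - C * ρ ≤ 6 * (N : ℝ) - (numContacts x : ℝ) := by
  intro hB
  refine ⟨1, 4 * Real.pi, one_pos, fun ρ hρ N x hx hP => ?_⟩
  rw [phiFcc_single_two]
  have hν : ‖EuclideanSpace.single (2 : Fin 3) (1 : ℝ)‖ = 1 := norm_e3
  have hinner : ∀ p : EuclideanSpace ℝ (Fin 3), ⟪p, EuclideanSpace.single (2 : Fin 3) (1 : ℝ)⟫_ℝ = p 2 :=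
    fun p => by simp [EuclideanSpace.inner_single_right]
  obtain ⟨hh2, hh45, hh89⟩ := sqrt_two_thirds_bounds
  -- the layer `k₀ = −2` is sampled
  have hlayer : ∀ i j : ℤ, barlowPos 1 (Real.sqrt (2 / 3)) constHagg (-2) i j 0 ^ 2 +
      barlowPos 1 (Real.sqrt (2 / 3)) constHagg (-2) i j 1 ^ 2 ≤ ρ ^ 2 →
      ∃ m, x m = barlowPos 1 (Real.sqrt (2 / 3)) constHagg (-2) i j := by
    intro i j hij
    refine hP _ (barlowPos_mem _ _ _) ?_ ?_ ?_
    · rw [hinner, barlowPos_apply_two]; push_cast; nlinarith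
    · rw [hinner, barlowPos_apply_two]; push_cast; nlinarith
    · rw [hinner, EuclideanSpace.real_norm_sq_eq, Fin.sum_univ_three]
      linarith
  have := blanket_core ρ hρ (-2) x hlayer (hB N x hx _ hν)
  linarith

/-- **`BlanketToNRGAtNeg3`** (the lower basal facet): the blanket bound implies
`NoReconstructionGain` at `ν = −e₃`, `R = 1`, `C = 4π`. -/
theorem blanket_noReconstructionGain_neg_e3 :
    (∀ (N : ℕ) (x : Fin N → EuclideanSpace ℝ (Fin 3)), IsUnitPacking x →
      ∀ ν : EuclideanSpace ℝ (Fin 3), ‖ν‖ = 1 →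
        2 * Real.sqrt 3 * (volume {y : EuclideanSpace ℝ (Fin 3) |
          (∃ i, ‖y - x i‖ ^ 2 - ⟪y - x i, ν⟫_ℝ ^ 2 ≤ (Real.sqrt 3)⁻¹ ^ 2) ∧
          |⟪y, ν⟫_ℝ| ≤ 1 / 2}).toReal ≤ 6 * (N : ℝ) - (numContacts x : ℝ)) →
    ∃ R C : ℝ, 0 < R ∧ ∀ ρ : ℝ, R ≤ ρ →
      ∀ (N : ℕ) (x : Fin N → EuclideanSpace ℝ (Fin 3)), IsUnitPacking x →
        (∀ p ∈ fccStacking 1 (Real.sqrt (2 / 3)),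
            -(2 * R) ≤ ⟪p, -EuclideanSpace.single (2 : Fin 3) (1 : ℝ)⟫_ℝ →
            ⟪p, -EuclideanSpace.single (2 : Fin 3) (1 : ℝ)⟫_ℝ ≤ -R →
            ‖p‖ ^ 2 - ⟪p, -EuclideanSpace.single (2 : Fin 3) (1 : ℝ)⟫_ℝ ^ 2 ≤ ρ ^ 2 → ∃ i, x i = p) →
          2 * (Real.sqrt 2 / 4 *
                ∑ᶠ w ∈ {w ∈ fccStacking 1 (Real.sqrt (2 / 3)) | ‖w‖ = 1},
                  |⟪w, -EuclideanSpace.single (2 : Fin 3) (1 : ℝ)⟫_ℝ|) *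
              Real.pi * ρ ^ 2 - C * ρ ≤ 6 * (N : ℝ) - (numContacts x : ℝ) := by
  intro hB
  refine ⟨1, 4 * Real.pi, one_pos, fun ρ hρ N x hx hP => ?_⟩
  simp only [inner_neg_right, abs_neg]
  rw [phiFcc_single_two]
  have hν : ‖EuclideanSpace.single (2 : Fin 3) (1 : ℝ)‖ = 1 := norm_e3
  have hinner : ∀ p : EuclideanSpace ℝ (Fin 3), ⟪p, EuclideanSpace.single (2 : Fin 3) (1 : ℝ)⟫_ℝ = p 2 :=
    fun p => by simp [EuclideanSpace.inner_single_right]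
  obtain ⟨hh2, hh45, hh89⟩ := sqrt_two_thirds_bounds
  -- the layer `k₀ = 2` is sampled
  have hlayer : ∀ i j : ℤ, barlowPos 1 (Real.sqrt (2 / 3)) constHagg 2 i j 0 ^ 2 +
      barlowPos 1 (Real.sqrt (2 / 3)) constHagg 2 i j 1 ^ 2 ≤ ρ ^ 2 →
      ∃ m, x m = barlowPos 1 (Real.sqrt (2 / 3)) constHagg 2 i j := by
    intro i j hij
    refine hP _ (barlowPos_mem _ _ _) ?_ ?_ ?_
    · rw [inner_neg_right, hinner, barlowPos_apply_two]; push_cast; nlinarith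
    · rw [inner_neg_right, hinner, barlowPos_apply_two]; push_cast; nlinarith
    · rw [inner_neg_right, hinner, EuclideanSpace.real_norm_sq_eq, Fin.sum_univ_three]
      linarith
  have hB' := hB N x hx _ hν
  have := blanket_core ρ hρ 2 x hlayer hB'
  linarith

end Summit.Ventures.Crystal3D.Theorems
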